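import Literature.Probability.RandomPlanarGeometry.SAWAllDimensionsEnvelope
import Literature.Probability.RandomPlanarGeometry.SAWLoopErasureKestenRenewalSharp
import Literature.Probability.RandomPlanarGeometry.SAWFiniteMemoryKernelK8
import HarnessLib

/-!
# Strict superadditivity of the connective constant in the dimension: `μ(ℤ^{d₁}) + μ(ℤ^{d₂}) < μ(ℤ^{d₁+d₂})`

Topic `Literature/Probability/RandomPlanarGeometry`; a leaf over the all-`d` envelope (`SAWAllDimensionsEnvelope`:
the floors `μ(ℤ³) > 73/18`, `μ(ℤ⁴) > 143/25`, `μ(ℤ⁵) > 373/50`), the renewal floor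
(`SAWLoopErasureKestenRenewalSharp`: `2d − 1 − 1/(2d) − 1/d² − 9/d³ − 204704/d⁴ ≤ μ(ℤ^d)`, `d ≥ 5`) and the two
kernel-checked (`decide`, axiom-standard) memory-8 ceiling `μ(ℤ²) ≤ 2.7445` (`SAWFiniteMemoryKernelK8`).

SOURCES AS PRINTED. Madras–Slade, *The Self-Avoiding Walk* (1993), §1.1, p. 5 (held text, PDF p. 22):
eq. (1.1.7) "`d ≤ μ ≤ 2d − 1`" ("The simple bounds of (1.1.1) then immediately imply that (1.1.7)") and
eq. (1.1.8) "as `d → ∞`, `μ = 2d − 1 − 1/(2d) − 3/(2d)² + O(1/(2d)³)`". Hara–Slade–Sokal 1993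
(arXiv:hep-lat/9302003, p. 27) eq. (6.20): `μ ≥ s⁻¹ − 1 − s − 4s² − 22s³ − 149s⁴ − …` (`s = 1/(2d)`).
Pönitz–Tittmann 2000, §1 p. 2 and Table 2: finite-memory upper bounds ("The values shown are true upper
bounds"; `d = 2`, memory `k = 8`: `2.7445`).

WHAT IS HERE (the lens "strict inequalities with computable margins from finite enumeration + a transfer
lemma"). The companion file `SAWDimensionSuperadditive` proves the soft law `μ(d₁) + μ(d₂) ≤ μ(d₁ + d₂)` by
two-block interleaving. This file proves the STRICT inequality wherever the tree's explicit bounds leave a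
computable margin:
* `two_mul_sub_two_lt_connectiveConstant : 2d − 2 < μ(ℤ^d)` for every `d ≥ 22` — the renewal floor exceeds
  `2d − 2` as soon as `d⁴ − d³/2 − d² − 9d − 204704 > 0`, i.e. from `d = 22` (`23546 > 0`; at `d = 21` the
  polynomial is `−15483 < 0`), the transfer step;
* `connectiveConstant_add_lt : μ(ℤ^{d₁}) + μ(ℤ^{d₂}) < μ(ℤ^{d₁+d₂})` for all `d₁, d₂ ≥ 1` with `d₁ + d₂ ≥ 22`
  (margin: `μ(dᵢ) ≤ 2dᵢ − 1` by (1.1.7), so the sum is `≤ 2(d₁+d₂) − 2`), in particular the strict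
  dimension gap `connectiveConstant_add_one_lt_of_ge : μ(ℤ^d) + 1 < μ(ℤ^{d+1})` for `d ≥ 21`;
* `connectiveConstant_strictSuperadditive_small : μ(1)+μ(1) < μ(2) ∧ μ(1)+μ(2) < μ(3) ∧ μ(2)+μ(2) < μ(4)` —
  the finite-enumeration instances, with margins `5/2 − 2 = 1/2`, `73/18 − 3.7445 = 0.311…`,
  `143/25 − 5.489 = 0.231` from the kernel-checked Kraft / Kesten-iteration floors and the memory-8 automaton
  ceiling `μ(ℤ²) ≤ 2.7445` — every declaration here is axiom-standard (`propext`, `Classical.choice`, `Quot.sound`).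
HONEST SCOPE. The other pairs with `4 ≤ d₁ + d₂ ≤ 21` are NOT decided here. `(2,3)` follows with margin `0.012`
from the tree's `native_decide` ceilings `μ(ℤ²) ≤ 2.688` (`SAWFiniteMemory18At2688`) and `μ(ℤ³) ≤ 4.76`
(`SAWFiniteMemoryZ3K10`) against `μ(ℤ⁵) > 373/50`; it is deliberately left out to keep this file free of compiled-
evaluation axioms. `(1,3)`: the tree has `μ(ℤ³) ≤ 4.76` but only `μ(ℤ⁴) > 5.72 < 5.76`; `(1,4)`: no ceiling on
`μ(ℤ⁴)` below `6.46` is landed; `(3,3)`: `2 · 4.76 = 9.52 > 231/25` — a sharper floor on `μ(ℤ⁴), μ(ℤ⁵), μ(ℤ⁶), …`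
or the third-order renewal floor (which lowers the threshold `22` to `19`) would extend the list; conjecturally
the strict law holds for all `d₁, d₂ ≥ 1`. No parity or bridge input; pure inequalities between landed constants.

## References
- [MS93] N. Madras, G. Slade, The Self-Avoiding Walk, Birkhäuser 1993 — §1.1, eqs. (1.1.7), (1.1.8), p. 5.
- [HSS93] T. Hara, G. Slade, A. D. Sokal, J. Stat. Phys. 72 (1993) 479–517, arXiv:hep-lat/9302003 — §6.3 eq. (6.20).
- [PT00] A. Pönitz, P. Tittmann, Improved upper bounds for self-avoiding walks in `ℤ^d`, Electron. J. Combin. 7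
  (2000) R21 — §1 p. 2, Table 2.
-/

noncomputable section

namespace Literature.Probability.RandomPlanarGeometry.SAW.Zd

/-- [folklore] The renewal floor beats `2d − 2` from `d = 22` on: the polynomial margin
`d⁴ − d³/2 − d² − 9d − 204704 > 0` for real `d ≥ 22`. -/
private lemma renewal_floor_poly_pos {x : ℝ} (hx : 22 ≤ x) :
    0 < x ^ 4 - x ^ 3 / 2 - x ^ 2 - 9 * x - 204704 := by
  have h0 : (0 : ℝ) ≤ x - 22 := by linarith
  have h1 : x ^ 4 - x ^ 3 / 2 - x ^ 2 - 9 * x - 204704 =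
      (x - 22) ^ 4 + 175 / 2 * (x - 22) ^ 3 + 2870 * (x - 22) ^ 2 + 41813 * (x - 22) + 23546 := by ring
  rw [h1]
  positivity

/-- **`2d − 2 < μ(ℤ^d)` for every `d ≥ 22`** (transfer step: the explicit renewal floor
`2d − 1 − 1/(2d) − 1/d² − 9/d³ − 204704/d⁴` of HSS93 (6.20) exceeds `2d − 2` from `d = 22` on).
[cite: HaraSladeSokal1993, Section 6.3, eq. (6.20); MadrasSlade1993, Section 1.1, eq. (1.1.8) (p. 5)] -/
theorem two_mul_sub_two_lt_connectiveConstant {d : ℕ} (hd : 22 ≤ d) :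
    2 * (d : ℝ) - 2 < connectiveConstant d := by
  have hfloor := LoopErasure.kesten_second_order_renewal_sharp₉ (d := d) (by omega)
  have hd' : (22 : ℝ) ≤ d := by exact_mod_cast hd
  have hd0 : (0 : ℝ) < d := by linarith
  have hpoly := renewal_floor_poly_pos hd'
  have hkey : 2 * (d : ℝ) - 2 <
      2 * (d : ℝ) - 1 - 1 / (2 * (d : ℝ)) - 1 / (d : ℝ) ^ 2 - 9 / (d : ℝ) ^ 3 - 204704 / (d : ℝ) ^ 4 := by
    have e : 2 * (d : ℝ) - 1 - 1 / (2 * (d : ℝ)) - 1 / (d : ℝ) ^ 2 - 9 / (d : ℝ) ^ 3 - 204704 / (d : ℝ) ^ 4 -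
        (2 * (d : ℝ) - 2) = ((d : ℝ) ^ 4 - (d : ℝ) ^ 3 / 2 - (d : ℝ) ^ 2 - 9 * d - 204704) / (d : ℝ) ^ 4 := by
      field_simp
      ring
    have hq : 0 < ((d : ℝ) ^ 4 - (d : ℝ) ^ 3 / 2 - (d : ℝ) ^ 2 - 9 * d - 204704) / (d : ℝ) ^ 4 :=
      div_pos hpoly (by positivity)
    linarith
  exact lt_of_lt_of_le hkey hfloor

/-- **Strict superadditivity in high total dimension**: `μ(ℤ^{d₁}) + μ(ℤ^{d₂}) < μ(ℤ^{d₁+d₂})` whenever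
`d₁, d₂ ≥ 1` and `d₁ + d₂ ≥ 22` (margin: `μ(dᵢ) ≤ 2dᵢ − 1` by (1.1.7), and `2(d₁+d₂) − 2 < μ(ℤ^{d₁+d₂})`).
[cite: MadrasSlade1993, Section 1.1, eq. (1.1.7)–(1.1.8) (p. 5); HaraSladeSokal1993, Section 6.3, eq. (6.20)] -/
theorem connectiveConstant_add_lt {d₁ d₂ : ℕ} (h₁ : 1 ≤ d₁) (h₂ : 1 ≤ d₂) (h : 22 ≤ d₁ + d₂) :
    connectiveConstant d₁ + connectiveConstant d₂ < connectiveConstant (d₁ + d₂) := by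
  have u₁ := (BDGS2012_connectiveConstant_bounds_holds d₁ h₁).2
  have u₂ := (BDGS2012_connectiveConstant_bounds_holds d₂ h₂).2
  have hl := two_mul_sub_two_lt_connectiveConstant h
  push_cast at hl
  linarith

/-- [folklore] `μ(ℤ¹) = 1`, from `d ≤ μ ≤ 2d − 1` at `d = 1`. -/
private lemma connectiveConstant_one_eq : connectiveConstant 1 = 1 := by
  have h := BDGS2012_connectiveConstant_bounds_holds 1 le_rfl
  norm_num at h
  linarith [h.1, h.2]

/-- **Strict dimension gap in high dimension**: `μ(ℤ^d) + 1 < μ(ℤ^{d+1})` for every `d ≥ 21` (the case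
`d₂ = 1` of `connectiveConstant_add_lt`, with `μ(ℤ¹) = 1`); compare the soft gap `μ(ℤ^d) + 1 ≤ μ(ℤ^{d+1})` of
`SAWDimensionGap.connectiveConstant_add_one_le`, valid for all `d`.
[cite: MadrasSlade1993, Section 1.1, eq. (1.1.7)–(1.1.8) (p. 5); HaraSladeSokal1993, Section 6.3, eq. (6.20)] -/
theorem connectiveConstant_add_one_lt_of_ge {d : ℕ} (hd : 21 ≤ d) :
    connectiveConstant d + 1 < connectiveConstant (d + 1) := by
  have h := connectiveConstant_add_lt (d₁ := d) (d₂ := 1) (by omega) le_rfl (by omega)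
  rwa [connectiveConstant_one_eq] at h

/-- **Strict superadditivity, the finite-enumeration instances**:
`μ(1)+μ(1) < μ(2)`, `μ(1)+μ(2) < μ(3)`, `μ(2)+μ(2) < μ(4)` — margins `1/2`, `0.311…`, `0.231` from the
kernel-checked floors `5/2 ≤ μ(2)`, `73/18 < μ(3)`, `143/25 < μ(4)` and the memory-8 automaton ceiling
`μ(2) ≤ 2.7445`.
[cite: MadrasSlade1993, Section 1.1, eq. (1.1.7) (p. 5)]
[cite: PonitzTittmann2000, Section 1 (p. 2) and Table 2 (d = 2, k = 8)] -/
theorem connectiveConstant_strictSuperadditive_small :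
    connectiveConstant 1 + connectiveConstant 1 < connectiveConstant 2 ∧
      connectiveConstant 1 + connectiveConstant 2 < connectiveConstant 3 ∧
        connectiveConstant 2 + connectiveConstant 2 < connectiveConstant 4 := by
  have h1 := connectiveConstant_one_eq
  have h2l := le_connectiveConstant_two_25
  have h2u := connectiveConstant_two_le_27445
  have h3l := connectiveConstant_three_gt_std
  have h4l := connectiveConstant_four_gt_std
  refine ⟨?_, ?_, ?_⟩
  · rw [h1]; norm_num at h2l ⊢; linarith
  · rw [h1]; norm_num at h2u h3l ⊢; linarith
  · norm_num at h2u h4l ⊢; linarith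

end Literature.Probability.RandomPlanarGeometry.SAW.Zd

end
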